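import Literature.Computability.AlgebraicComplexity.QuantumFunctionalsSpectralPoint
import Literature.Computability.AlgebraicComplexity.QuantumFunctionalsDirectSumUpper
import HarnessLib

/-!
# CVZ Cor. 3.31 from the upper-functional facts (Lemma 3.11, Lemma 3.13, Thm. 3.30)

Topic `Literature/Computability/AlgebraicComplexity`; second assembly layer for the named fact
`ChristandlVranaZuiddam2023_universalSpectralPoint` (`QuantumFunctionals.lean`, Christandl–Vrana–Zuiddam,
J. Amer. Math. Soc. 36 (2023), Cor. 3.31). `QuantumFunctionalsSpectralPoint.lean` reduces Cor. 3.31 to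
the two deep halves `ChristandlVranaZuiddam2023_directSum_subadditive` and
`ChristandlVranaZuiddam2023_kronecker_le`; `QuantumFunctionalsUpper.lean` defines the upper quantum
functional `F^θ` (Def. 3.3) and vendors Lemma 3.11 (`_upper_subadditive`), Lemma 3.13
(`_upper_submultiplicative`) and Thm. 3.30 (`_upper_eq_lower`), with the reductions
`ChristandlVranaZuiddam2023_kronecker_le_of_upper` and (in `QuantumFunctionalsDirectSumUpper.lean`)
`ChristandlVranaZuiddam2023_directSum_subadditive_of_upper`. This file composes them:
`ChristandlVranaZuiddam2023_universalSpectralPoint_of_upper` — Cor. 3.31 follows from the three printed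
upper-functional results, as in the source ("By the discussion at the beginning of this section the
following is immediate", before Cor. 3.31) — and `ChristandlVranaZuiddam2023_universalSpectralPoint_trustBase`,
the same statement with the remaining trust base spelled out as a conjunction. No definitions.

Source: M. Christandl, P. Vrana, J. Zuiddam, J. Amer. Math. Soc. 36 (2023) = arXiv:1709.07851v3,
Lemma 3.11, Lemma 3.13, Thm. 3.30, Cor. 3.31.
-/

noncomputable section

namespace Literature.Computability.AlgebraicComplexity

universe u

/-- **CVZ Cor. 3.31 from Lemma 3.11, Lemma 3.13 and Thm. 3.30**: the quantum functionals are universal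
spectral points (`ChristandlVranaZuiddam2023_universalSpectralPoint`: normalised, additive,
multiplicative, restriction-monotone) as soon as the upper quantum functional `F^θ` of Def. 3.3 is
sub-additive (Lemma 3.11) and sub-multiplicative (Lemma 3.13) and coincides with `F_θ` in the
singleton regime (Thm. 3.30); normalisation, super-additivity, super-multiplicativity and monotonicity
(Thm. 3.19) are proved in the tree. [cite: ChristandlVranaZuiddam2023, Cor. 3.31] -/
theorem ChristandlVranaZuiddam2023_universalSpectralPoint_of_upper
    (h₁₁ : ChristandlVranaZuiddam2023_upper_subadditive.{u})
    (h₁₃ : ChristandlVranaZuiddam2023_upper_submultiplicative.{u})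
    (h₃₀ : ChristandlVranaZuiddam2023_upper_eq_lower.{u}) :
    ChristandlVranaZuiddam2023_universalSpectralPoint.{u} :=
  ChristandlVranaZuiddam2023_universalSpectralPoint_of_halves
    (ChristandlVranaZuiddam2023_directSum_subadditive_of_upper h₁₁ h₃₀)
    (ChristandlVranaZuiddam2023_kronecker_le_of_upper h₁₃ h₃₀)

/-- **Trust base of Cor. 3.31 in the tree, as one implication**: the conjunction of the three vendored
upper-functional facts (Lemma 3.11 ∧ Lemma 3.13 ∧ Thm. 3.30) implies
`ChristandlVranaZuiddam2023_universalSpectralPoint`. [cite: ChristandlVranaZuiddam2023, Cor. 3.31] -/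
theorem ChristandlVranaZuiddam2023_universalSpectralPoint_trustBase :
    ChristandlVranaZuiddam2023_upper_subadditive.{u} ∧ ChristandlVranaZuiddam2023_upper_submultiplicative.{u} ∧
        ChristandlVranaZuiddam2023_upper_eq_lower.{u} →
      ChristandlVranaZuiddam2023_universalSpectralPoint.{u} :=
  fun h => ChristandlVranaZuiddam2023_universalSpectralPoint_of_upper h.1 h.2.1 h.2.2

end Literature.Computability.AlgebraicComplexity

end
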